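import Literature.NumberTheory.Sieve.SmoothStepA
import HarnessLib

/-!
# Removing the weight `1/log N(α)` by an exponential integral (smooth substitute for Hinz's (2.6))

Topic `Literature/NumberTheory/Sieve`, sub-namespace `LogIntegral`. Hinz passes from
`∑ χ(ω) log Nω` to `∑ χ(ω)` by Grotz's multidimensional partial summation (2.6)–(2.7). For the
smooth weights `Ω_k(α) = ∏_w k(log σ_wα − log M)` the weight `1/log N((α))` is removed instead by
the identity `1/L = ∫₀^∞ e^{−tL} dt` (`L = log N((α)) > 0`): since
`N((α))^{−t} = M^{−dt} ∏_w e^{−t(log σ_wα − log M)}` one has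
`Ω_k(α) N((α))^{−t} = M^{−dt} Ω_{k_t}(α)` with the twisted profile `k_t(v) = k(v) e^{−tv}`
(`weightΩ_twist`), hence for every finite set `S` of cube points and weights `c(α)` vanishing
where `N((α)) = 1`:

`∑_{α∈S} Ω_k(α) c(α)/log N((α)) = ∫₀^∞ (M^d)^{−t} (∑_{α∈S} Ω_{k_t}(α) c(α)) dt`   (`sum_div_log_eq_integral`).

With `c = Λ((α))·[α ≡ u]` this expresses the smooth prime-power counts through the `ψ_{Ω_{k_t}}` of
`SmoothBVCore`/`SmoothStepA`; `norm_integral_le_of_bound` turns a bound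
`|F(t)| ≤ A e^{ct}` into `|∫₀^∞ (M^d)^{−t} F(t) dt| ≤ A/(d log M − c)`.

## References

* J. Hinz, Acta Arith. 51 (1988), §2 (2.6)–(2.7) (the partial summation this replaces).
  [cite: Hinz1988, §2 (2.6)–(2.7)]
-/

noncomputable section

open Finset NumberField MeasureTheory Set Real
  Literature.NumberTheory.Sieve.NumberFieldLS Literature.NumberTheory.LFunctions
  Literature.NumberTheory.LFunctions.NumberField Literature.NumberTheory.Sieve.TypeTwoReparam
  Literature.NumberTheory.Sieve.TypeTwoBlock Literature.NumberTheory.Sieve.SmoothTypeOne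
open scoped Classical

namespace Literature.NumberTheory.Sieve.LogIntegral

variable {K : Type*} [Field K] [NumberField K]

local notation "d" => Module.finrank ℚ K
local notation "RP" => {w : NumberField.InfinitePlace K // NumberField.InfinitePlace.IsReal w}

/-! ## The exponential integral -/

/-- `∫₀^∞ e^{−Lt} dt = 1/L` for `L > 0`. [folklore] -/
theorem integral_exp_neg_mul {L : ℝ} (hL : 0 < L) : ∫ t in Ioi (0 : ℝ), Real.exp (-(L * t)) = 1 / L := by
  have h := integral_exp_mul_Ioi (a := -L) (by linarith) 0
  simp only [mul_zero, Real.exp_zero, neg_mul] at h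
  rw [h]; field_simp

/-- `t ↦ e^{−Lt}` is integrable on `(0, ∞)` for `L > 0`. [folklore] -/
theorem integrableOn_exp_neg_mul {L : ℝ} (hL : 0 < L) :
    IntegrableOn (fun t : ℝ => Real.exp (-(L * t))) (Ioi 0) := by
  have := exp_neg_integrableOn_Ioi 0 hL
  simpa [neg_mul] using this

/-! ## The twisted profile -/

/-- The twisted profile `k_t(v) = k(v) e^{−tv}`. [folklore] -/
def twist (k : ℝ → ℝ) (t : ℝ) (v : ℝ) : ℝ := k v * Real.exp (-(t * v))

/-- `k_0 = k`. [folklore] -/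
theorem twist_zero (k : ℝ → ℝ) : twist k 0 = k := by
  funext v; simp [twist]

/-- **`Ω_k(α) N((α))^{−t} = (M^d)^{−t} Ω_{k_t}(α)`** for `α ∈ A₀(M)` (`M > 0`), written as
`Ω_{k_t}(α) = Ω_k(α) · exp(−t (log N((α)) − d log M))`. [folklore] -/
theorem weightΩ_twist [IsTotallyReal K] (k : ℝ → ℝ) (t M : ℝ) {α : 𝓞 K} (hα : α ∈ cubeF K M) :
    weightΩ K (fun v => (twist k t v : ℂ)) M α =
      weightΩ K (fun v => (k v : ℂ)) M α *
        (Real.exp (-(t * (Real.log (Ideal.absNorm (Ideal.span {α}) : ℝ) - d * Real.log M))) : ℂ) := by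
  have hαpos := isTotPos_of_mem_cubeF hα
  unfold weightΩ twist
  rw [Finset.prod_congr rfl fun w _ => Complex.ofReal_mul _ _, Finset.prod_mul_distrib]
  congr 1
  rw [← Complex.ofReal_prod, ← Real.exp_sum]
  congr 1
  -- `∑_w −t ℓ_w = −t (log N − d log M)`
  rw [log_absNorm_span_eq_sum hαpos]
  simp only [Finset.sum_sub_distrib, Finset.sum_const, Finset.card_univ, SmoothCoset.card_RP_eq, nsmul_eq_mul,
    ← Finset.mul_sum, Finset.sum_neg_distrib]

/-! ## The integral representation -/

/-- **`∑_{α∈S} Ω_k(α) c(α)/log N((α)) = ∫₀^∞ (M^d)^{−t} ∑_{α∈S} Ω_{k_t}(α) c(α) dt`** for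
`S ⊆ A₀(M)` (`M > 0`) and weights `c` vanishing at the `α` with `N((α)) = 1`.
[cite: Hinz1988, §2 (2.6)–(2.7)] -/
theorem sum_div_log_eq_integral [IsTotallyReal K] (k : ℝ → ℝ) (M : ℝ) (S : Finset (𝓞 K))
    (hS : ∀ α ∈ S, α ∈ cubeF K M) (c : 𝓞 K → ℂ)
    (hc : ∀ α ∈ S, Ideal.absNorm (Ideal.span {α}) = 1 → c α = 0) :
    ∑ α ∈ S, weightΩ K (fun v => (k v : ℂ)) M α * c α / (Real.log (Ideal.absNorm (Ideal.span {α}) : ℝ) : ℂ) =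
      ∫ t in Ioi (0 : ℝ), (Real.exp (-(t * (d * Real.log M))) : ℂ) *
        ∑ α ∈ S, weightΩ K (fun v => (twist k t v : ℂ)) M α * c α := by
  -- termwise: `Ω c / L = ∫ e^{-tL} Ω c dt`, and `e^{-t d log M} Ω_{k_t} = e^{-tL} Ω_k`
  have hterm : ∀ α ∈ S, (fun t : ℝ => (Real.exp (-(t * (d * Real.log M))) : ℂ) *
      (weightΩ K (fun v => (twist k t v : ℂ)) M α * c α)) =
      fun t : ℝ => (Real.exp (-(Real.log (Ideal.absNorm (Ideal.span {α}) : ℝ) * t)) : ℂ) *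
        (weightΩ K (fun v => (k v : ℂ)) M α * c α) := by
    intro α hα
    funext t
    rw [weightΩ_twist k t M (hS α hα)]
    rw [show (Real.exp (-(t * (d * Real.log M))) : ℂ) * (weightΩ K (fun v => (k v : ℂ)) M α *
        (Real.exp (-(t * (Real.log (Ideal.absNorm (Ideal.span {α}) : ℝ) - d * Real.log M))) : ℂ) * c α) =
        ((Real.exp (-(t * (d * Real.log M))) * Real.exp (-(t * (Real.log (Ideal.absNorm (Ideal.span {α}) : ℝ) -
          d * Real.log M))) : ℝ) : ℂ) * (weightΩ K (fun v => (k v : ℂ)) M α * c α) by push_cast; ring]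
    rw [← Real.exp_add]
    congr 2; ring_nf
  -- integrability of each term
  have hint : ∀ α ∈ S, Integrable (fun t : ℝ => (Real.exp (-(t * (d * Real.log M))) : ℂ) *
      (weightΩ K (fun v => (twist k t v : ℂ)) M α * c α)) (volume.restrict (Ioi 0)) := by
    intro α hα
    rw [hterm α hα]
    by_cases hN : Ideal.absNorm (Ideal.span {α}) = 1
    · rw [hc α hα hN]; simp
    · have hL : 0 < Real.log (Ideal.absNorm (Ideal.span {α}) : ℝ) := by
        have h0 : α ≠ 0 := MitsuiPNT.ne_zero_of_mem_box₀ (mem_cubeF.1 (hS α hα))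
        have h1 : 1 ≤ Ideal.absNorm (Ideal.span {α}) :=
          Nat.one_le_iff_ne_zero.2 (by rw [Ne, Ideal.absNorm_eq_zero_iff, Ideal.span_singleton_eq_bot]; exact h0)
        have h2 : 1 < Ideal.absNorm (Ideal.span {α}) := lt_of_le_of_ne h1 (Ne.symm hN)
        exact Real.log_pos (by exact_mod_cast h2)
      have hi := (integrableOn_exp_neg_mul hL)
      have hi' : Integrable (fun t : ℝ => (Real.exp (-(Real.log (Ideal.absNorm (Ideal.span {α}) : ℝ) * t)) : ℂ))
          (volume.restrict (Ioi 0)) := hi.ofReal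
      exact hi'.mul_const _
  simp_rw [Finset.mul_sum]
  rw [integral_finsetSum _ hint]
  refine Finset.sum_congr rfl fun α hα => ?_
  rw [hterm α hα, integral_mul_const]
  by_cases hN : Ideal.absNorm (Ideal.span {α}) = 1
  · rw [hc α hα hN]; simp
  · have hL : 0 < Real.log (Ideal.absNorm (Ideal.span {α}) : ℝ) := by
      have h0 : α ≠ 0 := MitsuiPNT.ne_zero_of_mem_box₀ (mem_cubeF.1 (hS α hα))
      have h1 : 1 ≤ Ideal.absNorm (Ideal.span {α}) :=
        Nat.one_le_iff_ne_zero.2 (by rw [Ne, Ideal.absNorm_eq_zero_iff, Ideal.span_singleton_eq_bot]; exact h0)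
      have h2 : 1 < Ideal.absNorm (Ideal.span {α}) := lt_of_le_of_ne h1 (Ne.symm hN)
      exact Real.log_pos (by exact_mod_cast h2)
    have hI : ∫ t in Ioi (0 : ℝ), (Real.exp (-(Real.log (Ideal.absNorm (Ideal.span {α}) : ℝ) * t)) : ℂ) =
        ((1 / Real.log (Ideal.absNorm (Ideal.span {α}) : ℝ) : ℝ) : ℂ) := by
      rw [integral_complex_ofReal, integral_exp_neg_mul hL]
    rw [hI]
    push_cast
    field_simp

/-! ## Bounding the integral -/

/-- **`|∫₀^∞ e^{−Λt} F(t) dt| ≤ A/(Λ − c)`** if `‖F(t)‖ ≤ A e^{ct}` on `t > 0`, `Λ > c`, `A ≥ 0`, and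
the integrand is integrable. [folklore] -/
theorem norm_integral_le_of_bound {F : ℝ → ℂ} {Λ c A : ℝ} (hΛc : c < Λ)
    (hF : ∀ t, 0 < t → ‖F t‖ ≤ A * Real.exp (c * t))
    (hint : Integrable (fun t : ℝ => (Real.exp (-(t * Λ)) : ℂ) * F t) (volume.restrict (Ioi 0))) :
    ‖∫ t in Ioi (0 : ℝ), (Real.exp (-(t * Λ)) : ℂ) * F t‖ ≤ A / (Λ - c) := by
  have hpos : 0 < Λ - c := by linarith
  calc ‖∫ t in Ioi (0 : ℝ), (Real.exp (-(t * Λ)) : ℂ) * F t‖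
      ≤ ∫ t in Ioi (0 : ℝ), ‖(Real.exp (-(t * Λ)) : ℂ) * F t‖ := norm_integral_le_integral_norm _
    _ ≤ ∫ t in Ioi (0 : ℝ), A * Real.exp (-((Λ - c) * t)) := by
        refine setIntegral_mono_on hint.norm ?_ measurableSet_Ioi fun t ht => ?_
        · exact (integrableOn_exp_neg_mul hpos).const_mul A
        · rw [norm_mul, Complex.norm_real, Real.norm_eq_abs, abs_of_pos (Real.exp_pos _)]
          calc Real.exp (-(t * Λ)) * ‖F t‖ ≤ Real.exp (-(t * Λ)) * (A * Real.exp (c * t)) :=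
                mul_le_mul_of_nonneg_left (hF t ht) (Real.exp_pos _).le
            _ = A * Real.exp (-((Λ - c) * t)) := by
                rw [show -((Λ - c) * t) = -(t * Λ) + c * t by ring, Real.exp_add]; ring
    _ = A / (Λ - c) := by
        rw [integral_const_mul, integral_exp_neg_mul hpos]; ring

end Literature.NumberTheory.Sieve.LogIntegral
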